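import Summits.ABC.IUTFork.Cor312GenuineKTwistExactTriple
import HarnessLib

/-!
# The class-robust tame socket with the TWIST clause («W:REF-BANDS-EXACT» engine, part 3): at a pole `p ∉ {2, 3, 5, l}` of an abc triple with
# `v = v_p(abc)`, the local type `e(K_x/ℚ_p) = A·l` has `A ∣ 30`, `15 ∣ A·v`, (`v` even ⇒ `A ∣ 15`), (`3 ∣ v` ⇒ `A ∣ 10`), (`5 ∣ v` ⇒ `A ∣ 6`),
# (`p ∣ c`, `v` odd ⇒ `2 ∣ A`)

PROOF-ONLY file (D-0012; 0 definitions, 0 `Prop` facts, no instance) of the abc-iut cell — D-0079 RESCUE sub-cell R-W «WINDOW Θ-SIDE INEQUALITY»,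
seat abc-iut-W-neg-1 (gen 4), rows «W:REF-BANDS-EXACT» / «W:TWIST-EXACT». Sequel of this seat's `Cor312LicenceTripleHullCellRefuteTame` (p496736) and
`…TameSharp` (p498814): the kernel class handed to the consumer's cells gains the TWIST clause `p ∣ c ∧ v odd ⇒ 2 ∣ A` (this seat's
`WRow.localType_class_triple_twist`, `Cor312GenuineKTwistExactTriple`: `γ(E_{a/c})` is a square in `F_w` at bad places and `ord_p γ = v_p(c)`), so at a
pole `p ∣ c` of ODD multiplicity the consumer proves cells for the GENUINE class `{2e₀}` only (e.g. `19¹¹ ∥ c` ⇒ `{30}`; `23⁵ ∥ c` ⇒ `{6}`; `3677³ ∥ c`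
⇒ `{10}`) — the R-W numerics lead's desk rule «`t` odd ∧ `p ∣ c` ⇒ `{2e₀}`» as a kernel input. TAKES NO SIDE on [IUTchIII] Cor. 3.12 (S. Mochizuki,
*Inter-universal Teichmüller theory III*, Cor. 3.12 p. 173–174; Step (xi-f) p. 184) or on any author; «refuted as typed» ≠ «refuted in print».

WHAT IS PROVED (namespace `Summit.ABC.IUTFork.Conditional`): **`WRow.not_licence_triple_of_hullCells_tameTwist`** /
**`WRow.not_exists_qPinned_and_hull_triple_of_hullCells_tameTwist`** / **`GenuineK.not_pilotKummerCompatHull_chosen_triple_of_hullCells_tameTwist`** —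
as in parts 1–2 (the three W-lane shapes: ∀ realising ideles ¬Licence; branch C's antecedent FAILS; CHOSEN ideles, pinned reading), with `hcell`
quantified over the class `∀ A, A ∣ 30 → 15 ∣ A·v → (Even v → A ∣ 15) → (3 ∣ v → A ∣ 10) → (5 ∣ v → A ∣ 6) → (p ∣ c → Odd v → 2 ∣ A) → ∃ a₀, …`.
READING (neutral): a sufficient condition for the per-datum S_H object to FAIL at EVERY genuine datum of the class `(ratPoint (a/c), l)`, NO local-type
hypothesis; admissibility / Szpiro-badness / (P6) / NON-EMPTINESS are NOT claimed. HONEST SCOPE: OUR sharp containers and Dupuy–Hilado's typed (Ind1)/(Ind2);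
STRONGER-THAN-PRINT hull reading; nothing about the printed inequality, the number-level corollary or any author's intended hull; typed ≠ proved;
instantiated ≠ endorsed; no abc claim.
[cite: Mochizuki2012, IUTchI Ex. 3.2 (iv) p. 71; IUTchIII Cor. 3.12 Step (xi-f) p. 184; IUTchIV Prop. 1.1 p. 9, Prop. 1.2 (i)(ii) p. 10, Thm. 1.10 p. 22, Cor. 2.2 (ii) proof (P5) p. 46]
[cite: DupuyHilado2025, §3.3, §3.4, §4.9, §4.12] [cite: SilvermanATAEC1994, Lemma V.5.2, Thm. V.5.3 and Cor. V.5.4]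
[claim: Mochizuki2012, status: disputed] for every IUT sentence.
-/

noncomputable section

open Set Function Metric NumberField IsDedekindDomain

namespace Summit.ABC.IUTFork.Conditional

open Thm311 Thm311.Real Cor312 Cor312Vol Cor312Prov Literature.IUT.LogThetaLattice Literature.IUT.LogVolume
  Literature.IUT.HodgeTheaters Literature.IUT.LogVolume.Cor22 Literature.IUT.LogVolume.ThetaData
open Literature.NumberTheory.NumberFields Literature.NumberTheory.GaloisRepresentations.Ultrametric
open Literature.NumberTheory.DiophantineGeometry Literature.NumberTheory.DiophantineGeometry.GenEll
open Summit.ABC.IUTFork.Repair.RH.HullThresholdExact Summit.ABC.IUTFork.Repair.RH.HullThresholdExactRefute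
open Summit.ABC.IUTFork.Repair.RH.ReachLedgerQ2

/-! ## The class-robust socket over the class WITH THE TWIST CLAUSE (same three shapes as parts 1–2) -/

/-- **THE HULL LICENCE FAILS AT THE `K`-LEVEL DATUM OF AN abc TRIPLE WHEN R-H ROW 4's COLUMN FAILS AT A TAME POLE FOR EVERY MEMBER OF THE
KERNEL CLASS WITH THE TWIST CLAUSE.** `a + b = c` an abc triple, `l` any level, `T` a genuine Θ-volume datum at `(ratPoint (a/c), l)`, ideles REALISING
the pilot divisors of `X := pilotDataOfK T.D T.K`; a prime `p ∣ abc`, `p ∉ {2, 3, 5, l}`, `v := v_p(abc)`; a label `i + 1 ≤ (l−1)/2`; and for EVERY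
`A` with `A ∣ 30`, `15 ∣ A·v`, (`v` even ⇒ `A ∣ 15`), (`3 ∣ v` ⇒ `A ∣ 10`), (`5 ∣ v` ⇒ `A ∣ 6`), (`p ∣ c`, `v` odd ⇒ `2 ∣ A`) a turning point `a₀` of `A·l` with `¬ HullCell (A·l) (A·v) (i+1) (⌊A·l/(p−1)⌋+1) (p^{a₀} − a₀·A·l)`.
THEN `¬ Thm311ToCor312.Licence (settingPrVolSharp X …)`: the local type of one fibre point lies in the class and is the local type of EVERY fibre
point (§1), so abc-iut-w5-d009's pinned socket `WRow.not_licence_triple_of_not_hullCell` (p493429) applies with `(e₀, P) = (A·l, A·v)`.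
[cite: Mochizuki2012, IUTchI Ex. 3.2 (iv) p. 71; IUTchIII Cor. 3.12 Step (xi-f) p. 184; IUTchIV Prop. 1.1 p. 9, Prop. 1.2 (i)(ii) p. 10, Cor. 2.2 (ii) proof (P5) p. 46]
[cite: DupuyHilado2025, §3.4, §4.9, §4.12] [cite: SerreLocalFields1979, Ch. III §6 Prop. 13] [claim: Mochizuki2012, status: disputed] -/
theorem WRow.not_licence_triple_of_hullCells_tameTwist {a b c l : ℕ} (habc : IsABCTriple a b c)
    (T : Cor22.ThetaVolumeDatumAt (ratPoint ((a : ℚ) / c)) l) (pp : Nat.Primes) (hp2 : (pp : ℕ) ≠ 2) (hp3 : (pp : ℕ) ≠ 3)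
    (hp5 : (pp : ℕ) ≠ 5) (hpl : (pp : ℕ) ≠ l) (hpabc : (pp : ℕ) ∣ a * b * c) {v : ℕ} (hv : (a * b * c).factorization pp = v)
    {i : ℕ} (hi : i + 1 ≤ (l - 1) / 2)
    (hcell : ∀ A : ℕ, A ∣ 30 → 15 ∣ A * v → (Even v → A ∣ 15) → (3 ∣ v → A ∣ 10) → (5 ∣ v → A ∣ 6) → ((pp : ℕ) ∣ c → Odd v → 2 ∣ A) →
      ∃ a₀ : ℕ, (∀ s : ℕ, s < a₀ → (1 : ℤ) * ((pp : ℕ) : ℤ) ^ s * (((pp : ℕ) : ℤ) - 1) < ((A * l : ℕ) : ℤ)) ∧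
        ((A * l : ℕ) : ℤ) ≤ 1 * ((pp : ℕ) : ℤ) ^ a₀ * (((pp : ℕ) : ℤ) - 1) ∧
        ¬ HullCell ((A * l : ℕ) : ℤ) ((A * v : ℕ) : ℤ) ((i : ℤ) + 1) (((A * l) / ((pp : ℕ) - 1) + 1 : ℕ) : ℤ)
          (((pp : ℕ) : ℤ) ^ a₀ - (a₀ : ℤ) * ((A * l : ℕ) : ℤ))) :
    letI := T.instFieldF; letI := T.instNumberFieldF; letI := T.instAlgebraF; letI := T.instFieldK
    letI := T.instNumberFieldK; letI := T.instAlgebraK; letI := T.instFieldFbar; letI := T.instAlgebraFbar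
    letI := T.instAlgebraKFbar; letI := T.instIsElliptic
    ∀ {logv : PadicLogs T.K} (hlog : LogvAnalytic logv) (M : Type) [Field M] [NumberField M]
      (archPk : ∀ (j : (thetaIndex (pilotDataOfK T.D T.K)).Label) (vQ : (thetaIndex (pilotDataOfK T.D T.K)).VQ),
        Set ((logShellsDH (pilotDataOfK T.D T.K) logv).Packet j vQ))
      (archSub : ∀ (j : (thetaIndex (pilotDataOfK T.D T.K)).Label) (v : (thetaIndex (pilotDataOfK T.D T.K)).V),
        Set ((logShellsDH (pilotDataOfK T.D T.K) logv).Packet j ((thetaIndex (pilotDataOfK T.D T.K)).over v)))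
      (Ψ : ℤ → ∀ v : (thetaIndex (pilotDataOfK T.D T.K)).V, v ∈ (thetaIndex (pilotDataOfK T.D T.K)).Vbad →
        Set ((logShellsDH (pilotDataOfK T.D T.K) logv).StarPacket v))
      (act : ℤ → ∀ v : (thetaIndex (pilotDataOfK T.D T.K)).V, v ∈ (thetaIndex (pilotDataOfK T.D T.K)).Vbad →
        (logShellsDH (pilotDataOfK T.D T.K) logv).StarPacket v → Module.End ℚ ((logShellsDH (pilotDataOfK T.D T.K) logv).StarPacket v))
      (Mmod : ℤ → ∀ j : (thetaIndex (pilotDataOfK T.D T.K)).LabelStar, Set ((logShellsDH (pilotDataOfK T.D T.K) logv).GlobalPacket j.1))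
      (region : ℤ → ∀ j : (thetaIndex (pilotDataOfK T.D T.K)).LabelStar, FinDivisor M → ∀ vQ : (thetaIndex (pilotDataOfK T.D T.K)).VQ,
        Set ((logShellsDH (pilotDataOfK T.D T.K) logv).Packet j.1 vQ))
      (n : ℤ) {HT : Type} {LogLink : HT → HT → Type} {IsFull : ∀ {s t : HT}, LogLink s t → Prop}
      (lat : LGPGaussianLogThetaLattice LogLink IsFull)
      {Frd : Type} {IsoF : Frd → Frd → Type} {Ob : Frd → Type} {realify : Frd → Frd} {Strip : Type}
      {IsoS : Strip → Strip → Type} {Mv : ∀ v : (thetaIndex (pilotDataOfK T.D T.K)).V, v ∈ (thetaIndex (pilotDataOfK T.D T.K)).Vbad → Type}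
      [∀ v h, Monoid (Mv v h)]
      (sig : GlobalLGPFrobenioidSignature (thetaIndex (pilotDataOfK T.D T.K)).lstar (thetaIndex (pilotDataOfK T.D T.K)).V
        (· ∈ (thetaIndex (pilotDataOfK T.D T.K)).Vbad) Frd IsoF Ob realify Strip IsoS Mv)
      (split : SplittingMonoids Mv) {ObΔ : Type} {N : ∀ v : (thetaIndex (pilotDataOfK T.D T.K)).V, v ∈ (thetaIndex (pilotDataOfK T.D T.K)).Vbad → Type}
      [∀ v h, Monoid (N v h)] (qData : QPilotData ObΔ N)
      (tq : ∀ (pp : Nat.Primes) (x : (thetaIndex (pilotDataOfK T.D T.K)).Fibre (.inr pp)),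
        haveI : Fact (pp : ℕ).Prime := ⟨pp.2⟩; kOf (pilotDataOfK T.D T.K) pp.1 x)
      (t : ∀ (pp : Nat.Primes) (_ : Fin (pilotDataOfK T.D T.K).lstar) (x : (thetaIndex (pilotDataOfK T.D T.K)).Fibre (.inr pp)),
        haveI : Fact (pp : ℕ).Prime := ⟨pp.2⟩; kOf (pilotDataOfK T.D T.K) pp.1 x)
      (htq0 : ∀ pp x, tq pp x ≠ 0)
      (htq1 : ∀ (pp : Nat.Primes) (x : (thetaIndex (pilotDataOfK T.D T.K)).Fibre (.inr pp)),
        haveI : Fact (pp : ℕ).Prime := ⟨pp.2⟩; placeOf (pilotDataOfK T.D T.K) pp.1 x ∉ (pilotDataOfK T.D T.K).S → ‖tq pp x‖ = 1)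
      (_ht0 : ∀ pp i x, t pp i x ≠ 0)
      (_ht : ∀ (pp : Nat.Primes) (i : Fin (pilotDataOfK T.D T.K).lstar) (x : (thetaIndex (pilotDataOfK T.D T.K)).Fibre (.inr pp)),
        haveI : Fact (pp : ℕ).Prime := ⟨pp.2⟩
        Real.log ‖t pp i x‖ = -((pilotDataOfK T.D T.K).thetaPilot i (placeOf (pilotDataOfK T.D T.K) pp.1 x)) *
          logNorm T.K (placeOf (pilotDataOfK T.D T.K) pp.1 x) / localDegree T.K (placeOf (pilotDataOfK T.D T.K) pp.1 x))
      (_htq : ∀ (pp : Nat.Primes) (x : (thetaIndex (pilotDataOfK T.D T.K)).Fibre (.inr pp)),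
        haveI : Fact (pp : ℕ).Prime := ⟨pp.2⟩
        Real.log ‖tq pp x‖ = -((pilotDataOfK T.D T.K).qPilot (placeOf (pilotDataOfK T.D T.K) pp.1 x)) *
          logNorm T.K (placeOf (pilotDataOfK T.D T.K) pp.1 x) / localDegree T.K (placeOf (pilotDataOfK T.D T.K) pp.1 x)),
      ¬ Thm311ToCor312.Licence
        (settingPrVolSharp (pilotDataOfK T.D T.K) hlog M archPk archSub Ψ act Mmod region n lat sig split qData tq t htq0 htq1) := by
  letI := T.instFieldF; letI := T.instNumberFieldF; letI := T.instAlgebraF; letI := T.instFieldK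
  letI := T.instNumberFieldK; letI := T.instAlgebraK; letI := T.instFieldFbar; letI := T.instAlgebraFbar
  letI := T.instAlgebraKFbar; letI := T.instIsElliptic
  haveI : Fact (pp : ℕ).Prime := ⟨pp.2⟩
  intro logv hlog M _ _ archPk archSub Ψ act Mmod region n HT LogLink IsFull lat Frd IsoF Ob realify Strip
    IsoS Mv _ sig split ObΔ N _ qData tq t htq0 htq1 ht0 ht htq
  obtain ⟨u, hu⟩ := (thetaIndex (pilotDataOfK T.D T.K)).fibre_nonempty (.inr pp)
  obtain ⟨A, hA, h30, h15, hpar, h3, h5, htw, hpe⟩ := WRow.localType_class_triple_twist habc T pp hp2 hp3 hp5 hpl hpabc hv ⟨u, hu⟩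
  obtain ⟨a₀, hlo, hhi, hneg⟩ := hcell A h30 h15 hpar h3 h5 htw
  have hloc : letI := T.instFieldF; letI := T.instNumberFieldF; letI := T.instAlgebraF; letI := T.instFieldK
      letI := T.instNumberFieldK; letI := T.instAlgebraK; letI := T.instFieldFbar; letI := T.instAlgebraFbar
      letI := T.instAlgebraKFbar; letI := T.instIsElliptic
      haveI : Fact (pp : ℕ).Prime := ⟨pp.2⟩
      ∀ x₀ : (thetaIndex (pilotDataOfK T.D T.K)).Fibre (.inr pp),
        absRamificationIdx (pp : ℕ) (kOf (pilotDataOfK T.D T.K) pp.1 x₀) = A * l := fun x₀ =>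
    (WRow.absRamificationIdx_kOf_eq_of_ratPoint T pp x₀ ⟨u, hu⟩).trans hA
  exact WRow.not_licence_triple_of_not_hullCell habc T pp hp2 hpl hpabc (e₀ := A * l) (P := A * v) (i := i) (a₀ := a₀) hpe hloc
    (by rw [hv]; ring) hi hlo hhi hneg hlog M archPk archSub Ψ act Mmod region n lat sig split qData tq t htq0 htq1 ht0 ht htq

/-- **… hence BRANCH C's PER-DATUM ANTECEDENT FAILS** under the same class-cell hypotheses: NO `ρ`, `qK` with `QPinned ∧ PilotKummerCompatHull`
at `settingPrVolSharp (pilotDataOfK T.D T.K) …`, for ANY columns and EVERY pair of realising ideles (the binder shape of `hSHw`/`hSHwBad`,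
p453137 / p450130; abc-iut-w5-d009's `exists_qPinned_and_hull_settingPrVolSharp_iff_licence`, realising q-ideles have norm `≤ 1`).
[cite: Mochizuki2012, IUTchIII Cor. 3.12 Step (xi-d) p. 183, (xi-f) p. 184] [cite: DupuyHilado2025, §3.4, §4.9, §4.12] [claim: Mochizuki2012, status: disputed] -/
theorem WRow.not_exists_qPinned_and_hull_triple_of_hullCells_tameTwist {a b c l : ℕ} (habc : IsABCTriple a b c)
    (T : Cor22.ThetaVolumeDatumAt (ratPoint ((a : ℚ) / c)) l) (pp : Nat.Primes) (hp2 : (pp : ℕ) ≠ 2) (hp3 : (pp : ℕ) ≠ 3)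
    (hp5 : (pp : ℕ) ≠ 5) (hpl : (pp : ℕ) ≠ l) (hpabc : (pp : ℕ) ∣ a * b * c) {v : ℕ} (hv : (a * b * c).factorization pp = v)
    {i : ℕ} (hi : i + 1 ≤ (l - 1) / 2)
    (hcell : ∀ A : ℕ, A ∣ 30 → 15 ∣ A * v → (Even v → A ∣ 15) → (3 ∣ v → A ∣ 10) → (5 ∣ v → A ∣ 6) → ((pp : ℕ) ∣ c → Odd v → 2 ∣ A) →
      ∃ a₀ : ℕ, (∀ s : ℕ, s < a₀ → (1 : ℤ) * ((pp : ℕ) : ℤ) ^ s * (((pp : ℕ) : ℤ) - 1) < ((A * l : ℕ) : ℤ)) ∧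
        ((A * l : ℕ) : ℤ) ≤ 1 * ((pp : ℕ) : ℤ) ^ a₀ * (((pp : ℕ) : ℤ) - 1) ∧
        ¬ HullCell ((A * l : ℕ) : ℤ) ((A * v : ℕ) : ℤ) ((i : ℤ) + 1) (((A * l) / ((pp : ℕ) - 1) + 1 : ℕ) : ℤ)
          (((pp : ℕ) : ℤ) ^ a₀ - (a₀ : ℤ) * ((A * l : ℕ) : ℤ))) :
    letI := T.instFieldF; letI := T.instNumberFieldF; letI := T.instAlgebraF; letI := T.instFieldK
    letI := T.instNumberFieldK; letI := T.instAlgebraK; letI := T.instFieldFbar; letI := T.instAlgebraFbar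
    letI := T.instAlgebraKFbar; letI := T.instIsElliptic
    ∀ {logv : PadicLogs T.K} (hlog : LogvAnalytic logv) (M : Type) [Field M] [NumberField M]
      (archPk : ∀ (j : (thetaIndex (pilotDataOfK T.D T.K)).Label) (vQ : (thetaIndex (pilotDataOfK T.D T.K)).VQ),
        Set ((logShellsDH (pilotDataOfK T.D T.K) logv).Packet j vQ))
      (archSub : ∀ (j : (thetaIndex (pilotDataOfK T.D T.K)).Label) (v : (thetaIndex (pilotDataOfK T.D T.K)).V),
        Set ((logShellsDH (pilotDataOfK T.D T.K) logv).Packet j ((thetaIndex (pilotDataOfK T.D T.K)).over v)))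
      (Ψ : ℤ → ∀ v : (thetaIndex (pilotDataOfK T.D T.K)).V, v ∈ (thetaIndex (pilotDataOfK T.D T.K)).Vbad →
        Set ((logShellsDH (pilotDataOfK T.D T.K) logv).StarPacket v))
      (act : ℤ → ∀ v : (thetaIndex (pilotDataOfK T.D T.K)).V, v ∈ (thetaIndex (pilotDataOfK T.D T.K)).Vbad →
        (logShellsDH (pilotDataOfK T.D T.K) logv).StarPacket v → Module.End ℚ ((logShellsDH (pilotDataOfK T.D T.K) logv).StarPacket v))
      (Mmod : ℤ → ∀ j : (thetaIndex (pilotDataOfK T.D T.K)).LabelStar, Set ((logShellsDH (pilotDataOfK T.D T.K) logv).GlobalPacket j.1))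
      (region : ℤ → ∀ j : (thetaIndex (pilotDataOfK T.D T.K)).LabelStar, FinDivisor M → ∀ vQ : (thetaIndex (pilotDataOfK T.D T.K)).VQ,
        Set ((logShellsDH (pilotDataOfK T.D T.K) logv).Packet j.1 vQ))
      (n : ℤ) {HT : Type} {LogLink : HT → HT → Type} {IsFull : ∀ {s t : HT}, LogLink s t → Prop}
      (lat : LGPGaussianLogThetaLattice LogLink IsFull)
      {Frd : Type} {IsoF : Frd → Frd → Type} {Ob : Frd → Type} {realify : Frd → Frd} {Strip : Type}
      {IsoS : Strip → Strip → Type} {Mv : ∀ v : (thetaIndex (pilotDataOfK T.D T.K)).V, v ∈ (thetaIndex (pilotDataOfK T.D T.K)).Vbad → Type}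
      [∀ v h, Monoid (Mv v h)]
      (sig : GlobalLGPFrobenioidSignature (thetaIndex (pilotDataOfK T.D T.K)).lstar (thetaIndex (pilotDataOfK T.D T.K)).V
        (· ∈ (thetaIndex (pilotDataOfK T.D T.K)).Vbad) Frd IsoF Ob realify Strip IsoS Mv)
      (split : SplittingMonoids Mv) {ObΔ : Type} {N : ∀ v : (thetaIndex (pilotDataOfK T.D T.K)).V, v ∈ (thetaIndex (pilotDataOfK T.D T.K)).Vbad → Type}
      [∀ v h, Monoid (N v h)] (qData : QPilotData ObΔ N)
      (tq : ∀ (pp : Nat.Primes) (x : (thetaIndex (pilotDataOfK T.D T.K)).Fibre (.inr pp)),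
        haveI : Fact (pp : ℕ).Prime := ⟨pp.2⟩; kOf (pilotDataOfK T.D T.K) pp.1 x)
      (t : ∀ (pp : Nat.Primes) (_ : Fin (pilotDataOfK T.D T.K).lstar) (x : (thetaIndex (pilotDataOfK T.D T.K)).Fibre (.inr pp)),
        haveI : Fact (pp : ℕ).Prime := ⟨pp.2⟩; kOf (pilotDataOfK T.D T.K) pp.1 x)
      (htq0 : ∀ pp x, tq pp x ≠ 0)
      (htq1 : ∀ (pp : Nat.Primes) (x : (thetaIndex (pilotDataOfK T.D T.K)).Fibre (.inr pp)),
        haveI : Fact (pp : ℕ).Prime := ⟨pp.2⟩; placeOf (pilotDataOfK T.D T.K) pp.1 x ∉ (pilotDataOfK T.D T.K).S → ‖tq pp x‖ = 1)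
      (col : ℤ → Column (logShellsDH (pilotDataOfK T.D T.K) logv))
      (_ht0 : ∀ pp i x, t pp i x ≠ 0)
      (_ht : ∀ (pp : Nat.Primes) (i : Fin (pilotDataOfK T.D T.K).lstar) (x : (thetaIndex (pilotDataOfK T.D T.K)).Fibre (.inr pp)),
        haveI : Fact (pp : ℕ).Prime := ⟨pp.2⟩
        Real.log ‖t pp i x‖ = -((pilotDataOfK T.D T.K).thetaPilot i (placeOf (pilotDataOfK T.D T.K) pp.1 x)) *
          logNorm T.K (placeOf (pilotDataOfK T.D T.K) pp.1 x) / localDegree T.K (placeOf (pilotDataOfK T.D T.K) pp.1 x))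
      (_htq : ∀ (pp : Nat.Primes) (x : (thetaIndex (pilotDataOfK T.D T.K)).Fibre (.inr pp)),
        haveI : Fact (pp : ℕ).Prime := ⟨pp.2⟩
        Real.log ‖tq pp x‖ = -((pilotDataOfK T.D T.K).qPilot (placeOf (pilotDataOfK T.D T.K) pp.1 x)) *
          logNorm T.K (placeOf (pilotDataOfK T.D T.K) pp.1 x) / localDegree T.K (placeOf (pilotDataOfK T.D T.K) pp.1 x)),
      ¬ ∃ (ρ : (∀ v : (thetaIndex (pilotDataOfK T.D T.K)).V, v ∈ (thetaIndex (pilotDataOfK T.D T.K)).Vbad →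
              Set ((logShellsDH (pilotDataOfK T.D T.K) logv).StarPacket v)) →
            ∀ (j : (thetaIndex (pilotDataOfK T.D T.K)).Label) (vQ : (thetaIndex (pilotDataOfK T.D T.K)).VQ),
              Set ((logShellsDH (pilotDataOfK T.D T.K) logv).Packet j vQ))
          (qK : ∀ v : (thetaIndex (pilotDataOfK T.D T.K)).V, v ∈ (thetaIndex (pilotDataOfK T.D T.K)).Vbad →
            Set ((logShellsDH (pilotDataOfK T.D T.K) logv).StarPacket v)),
          QPinned ({ toSituation := situationPrVol (pilotDataOfK T.D T.K) hlog M archPk archSub Ψ act Mmod region, col := col } :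
              LatticeSituation (thetaIndex (pilotDataOfK T.D T.K)))
            (settingPrVolSharp (pilotDataOfK T.D T.K) hlog M archPk archSub Ψ act Mmod region n lat sig split qData tq t htq0 htq1) ρ qK ∧
          PilotKummerCompatHull ({ toSituation := situationPrVol (pilotDataOfK T.D T.K) hlog M archPk archSub Ψ act Mmod region, col := col } :
              LatticeSituation (thetaIndex (pilotDataOfK T.D T.K)))
            (settingPrVolSharp (pilotDataOfK T.D T.K) hlog M archPk archSub Ψ act Mmod region n lat sig split qData tq t htq0 htq1) ρ qK := by
  letI := T.instFieldF; letI := T.instNumberFieldF; letI := T.instAlgebraF; letI := T.instFieldK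
  letI := T.instNumberFieldK; letI := T.instAlgebraK; letI := T.instFieldFbar; letI := T.instAlgebraFbar
  letI := T.instAlgebraKFbar; letI := T.instIsElliptic
  intro logv hlog M _ _ archPk archSub Ψ act Mmod region n HT LogLink IsFull lat Frd IsoF Ob realify Strip
    IsoS Mv _ sig split ObΔ N _ qData tq t htq0 htq1 col ht0 ht htq h
  have hL := (exists_qPinned_and_hull_settingPrVolSharp_iff_licence (pilotDataOfK T.D T.K) hlog M archPk archSub Ψ act Mmod region n
    lat sig split qData tq t htq0 htq1 col (fun pp x => norm_qIdele_le_one_of_realises (pilotDataOfK T.D T.K) tq htq0 htq pp x)).1 h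
  exact WRow.not_licence_triple_of_hullCells_tameTwist habc T pp hp2 hp3 hp5 hpl hpabc hv hi hcell hlog M archPk archSub Ψ act Mmod
    region n lat sig split qData tq t htq0 htq1 ht0 ht htq hL

/-- **… and in the INSTANCE SHAPE of the W-lane row theorems** (the per-datum object of the window binders `hSHw`/`hSHwBad`): for every genuine
Θ-volume datum `T` over `(ratPoint (a/c), l)` and EVERY choice of the free context binders and Kummer datum, `Cor312Vol.PilotKummerCompatHull` at
`settingPrVolSharp (pilotDataOfK T.D T.K) …` with the CHOSEN realising ideles and the PINNED reading FAILS, under the class-cell hypotheses alone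
(the q-pin holds by `rfl`, abc-iut-c312-1's `licence_of_pilotKummerCompatHull`). «refuted as typed» ≠ «refuted in print».
[cite: Mochizuki2012, IUTchIII Cor. 3.12 Step (xi-f) p. 184; IUTchIV Prop. 1.2 (i)(ii) p. 10] [cite: DupuyHilado2025, §3.4, §4.9] [claim: Mochizuki2012, status: disputed] -/
theorem GenuineK.not_pilotKummerCompatHull_chosen_triple_of_hullCells_tameTwist {a b c l : ℕ} (habc : IsABCTriple a b c)
    (T : Cor22.ThetaVolumeDatumAt (ratPoint ((a : ℚ) / c)) l) (pp : Nat.Primes) (hp2 : (pp : ℕ) ≠ 2) (hp3 : (pp : ℕ) ≠ 3)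
    (hp5 : (pp : ℕ) ≠ 5) (hpl : (pp : ℕ) ≠ l) (hpabc : (pp : ℕ) ∣ a * b * c) {v : ℕ} (hv : (a * b * c).factorization pp = v)
    {i : ℕ} (hi : i + 1 ≤ (l - 1) / 2)
    (hcell : ∀ A : ℕ, A ∣ 30 → 15 ∣ A * v → (Even v → A ∣ 15) → (3 ∣ v → A ∣ 10) → (5 ∣ v → A ∣ 6) → ((pp : ℕ) ∣ c → Odd v → 2 ∣ A) →
      ∃ a₀ : ℕ, (∀ s : ℕ, s < a₀ → (1 : ℤ) * ((pp : ℕ) : ℤ) ^ s * (((pp : ℕ) : ℤ) - 1) < ((A * l : ℕ) : ℤ)) ∧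
        ((A * l : ℕ) : ℤ) ≤ 1 * ((pp : ℕ) : ℤ) ^ a₀ * (((pp : ℕ) : ℤ) - 1) ∧
        ¬ HullCell ((A * l : ℕ) : ℤ) ((A * v : ℕ) : ℤ) ((i : ℤ) + 1) (((A * l) / ((pp : ℕ) - 1) + 1 : ℕ) : ℤ)
          (((pp : ℕ) : ℤ) ^ a₀ - (a₀ : ℤ) * ((A * l : ℕ) : ℤ))) :
    letI := T.instFieldF; letI := T.instNumberFieldF; letI := T.instAlgebraF; letI := T.instFieldK
    letI := T.instNumberFieldK; letI := T.instAlgebraK; letI := T.instFieldFbar; letI := T.instAlgebraFbar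
    letI := T.instAlgebraKFbar; letI := T.instIsElliptic
    ∀ (M : Type) [Field M] [NumberField M]
      (archPk : ∀ (j : (thetaIndex (pilotDataOfK T.D T.K)).Label) (vQ : (thetaIndex (pilotDataOfK T.D T.K)).VQ),
        Set ((logShellsDH (pilotDataOfK T.D T.K) (analyticLogv T.K)).Packet j vQ))
      (archSub : ∀ (j : (thetaIndex (pilotDataOfK T.D T.K)).Label) (v : (thetaIndex (pilotDataOfK T.D T.K)).V),
        Set ((logShellsDH (pilotDataOfK T.D T.K) (analyticLogv T.K)).Packet j ((thetaIndex (pilotDataOfK T.D T.K)).over v)))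
      (Ψ : ℤ → ∀ v : (thetaIndex (pilotDataOfK T.D T.K)).V, v ∈ (thetaIndex (pilotDataOfK T.D T.K)).Vbad →
        Set ((logShellsDH (pilotDataOfK T.D T.K) (analyticLogv T.K)).StarPacket v))
      (act : ℤ → ∀ v : (thetaIndex (pilotDataOfK T.D T.K)).V, v ∈ (thetaIndex (pilotDataOfK T.D T.K)).Vbad →
        (logShellsDH (pilotDataOfK T.D T.K) (analyticLogv T.K)).StarPacket v →
          Module.End ℚ ((logShellsDH (pilotDataOfK T.D T.K) (analyticLogv T.K)).StarPacket v))
      (Mmod : ℤ → ∀ j : (thetaIndex (pilotDataOfK T.D T.K)).LabelStar,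
        Set ((logShellsDH (pilotDataOfK T.D T.K) (analyticLogv T.K)).GlobalPacket j.1))
      (region : ℤ → ∀ j : (thetaIndex (pilotDataOfK T.D T.K)).LabelStar, FinDivisor M →
        ∀ vQ : (thetaIndex (pilotDataOfK T.D T.K)).VQ, Set ((logShellsDH (pilotDataOfK T.D T.K) (analyticLogv T.K)).Packet j.1 vQ))
      (frobAdm : ℤ → ℤ → ∀ (j : (thetaIndex (pilotDataOfK T.D T.K)).Label) (vQ : (thetaIndex (pilotDataOfK T.D T.K)).VQ),
        Set ((logShellsDH (pilotDataOfK T.D T.K) (analyticLogv T.K)).Packet j vQ) → Prop)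
      (frobLogvol : ℤ → ℤ → ∀ (j : (thetaIndex (pilotDataOfK T.D T.K)).Label) (vQ : (thetaIndex (pilotDataOfK T.D T.K)).VQ),
        Set ((logShellsDH (pilotDataOfK T.D T.K) (analyticLogv T.K)).Packet j vQ) → ℝ)
      (frobΨ : ℤ → ℤ → ∀ v : (thetaIndex (pilotDataOfK T.D T.K)).V, v ∈ (thetaIndex (pilotDataOfK T.D T.K)).Vbad →
        Set ((logShellsDH (pilotDataOfK T.D T.K) (analyticLogv T.K)).StarPacket v))
      (frobMmod : ℤ → ℤ → ∀ j : (thetaIndex (pilotDataOfK T.D T.K)).LabelStar,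
        Set ((logShellsDH (pilotDataOfK T.D T.K) (analyticLogv T.K)).GlobalPacket j.1))
      (unitImage : ℤ → ℤ → ℕ → ∀ (j : (thetaIndex (pilotDataOfK T.D T.K)).Label) (vQ : (thetaIndex (pilotDataOfK T.D T.K)).VQ),
        Set ((logShellsDH (pilotDataOfK T.D T.K) (analyticLogv T.K)).Packet j vQ))
      (ballImage : ℤ → ℤ → ∀ (j : (thetaIndex (pilotDataOfK T.D T.K)).Label) (vQ : (thetaIndex (pilotDataOfK T.D T.K)).VQ),
        Set ((logShellsDH (pilotDataOfK T.D T.K) (analyticLogv T.K)).Packet j vQ))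
      (thetaDiv : ℤ → ℤ → LgpDivisor M (thetaIndex (pilotDataOfK T.D T.K)).lstar)
      (n : ℤ) {HT : Type} {LogLink : HT → HT → Type} {IsFull : ∀ {s t : HT}, LogLink s t → Prop}
      (lat : LGPGaussianLogThetaLattice LogLink IsFull)
      {Frd : Type} {IsoF : Frd → Frd → Type} {Ob : Frd → Type} {realify : Frd → Frd} {Strip : Type}
      {IsoS : Strip → Strip → Type} {Mv : ∀ v : (thetaIndex (pilotDataOfK T.D T.K)).V, v ∈ (thetaIndex (pilotDataOfK T.D T.K)).Vbad → Type}
      [∀ v h, Monoid (Mv v h)]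
      (sig : GlobalLGPFrobenioidSignature (thetaIndex (pilotDataOfK T.D T.K)).lstar (thetaIndex (pilotDataOfK T.D T.K)).V
        (· ∈ (thetaIndex (pilotDataOfK T.D T.K)).Vbad) Frd IsoF Ob realify Strip IsoS Mv)
      (split : SplittingMonoids Mv) {ObΔ : Type}
      {N : ∀ v : (thetaIndex (pilotDataOfK T.D T.K)).V, v ∈ (thetaIndex (pilotDataOfK T.D T.K)).Vbad → Type}
      [∀ v h, Monoid (N v h)] (qData : QPilotData ObΔ N)
      (qK : ∀ v : (thetaIndex (pilotDataOfK T.D T.K)).V, v ∈ (thetaIndex (pilotDataOfK T.D T.K)).Vbad →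
        Set ((logShellsDH (pilotDataOfK T.D T.K) (analyticLogv T.K)).StarPacket v)),
    ¬ Cor312Vol.PilotKummerCompatHull
        (LatticeSituation.ofShells (logShellsDH (pilotDataOfK T.D T.K) (analyticLogv T.K)) M archPk archSub
          (summandPiecesPr (pilotDataOfK T.D T.K) (logvAnalytic_analyticLogv (F := T.K))).Adm
          (summandPiecesPr (pilotDataOfK T.D T.K) (logvAnalytic_analyticLogv (F := T.K))).logvol Ψ act Mmod region frobAdm
          frobLogvol frobΨ frobMmod unitImage ballImage thetaDiv)
        (settingPrVolSharp (pilotDataOfK T.D T.K) (logvAnalytic_analyticLogv (F := T.K)) M archPk archSub Ψ act Mmod region n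
          lat sig split qData (exists_realising_qIdeles_pilotDataOfK T.D).choose (exists_realising_thetaIdeles_pilotDataOfK T.D).choose
          (exists_realising_qIdeles_pilotDataOfK T.D).choose_spec.1 (exists_realising_qIdeles_pilotDataOfK T.D).choose_spec.2.1)
        (fun _ => Cor312.Setting.qRegion
          (settingPrVolSharp (pilotDataOfK T.D T.K) (logvAnalytic_analyticLogv (F := T.K)) M archPk archSub Ψ act Mmod region n
            lat sig split qData (exists_realising_qIdeles_pilotDataOfK T.D).choose (exists_realising_thetaIdeles_pilotDataOfK T.D).choose
            (exists_realising_qIdeles_pilotDataOfK T.D).choose_spec.1 (exists_realising_qIdeles_pilotDataOfK T.D).choose_spec.2.1))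
        qK := by
  letI := T.instFieldF; letI := T.instNumberFieldF; letI := T.instAlgebraF; letI := T.instFieldK
  letI := T.instNumberFieldK; letI := T.instAlgebraK; letI := T.instFieldFbar; letI := T.instAlgebraFbar
  letI := T.instAlgebraKFbar; letI := T.instIsElliptic
  intro M _ _ archPk archSub Ψ act Mmod region frobAdm frobLogvol frobΨ frobMmod
    unitImage ballImage thetaDiv n HT LogLink IsFull lat Frd IsoF Ob realify Strip IsoS Mv _ sig split ObΔ N _ qData qK hSH
  have hL := licence_of_pilotKummerCompatHull (hq := fun _ _ => rfl) (hc := hSH)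
  exact WRow.not_licence_triple_of_hullCells_tameTwist habc T pp hp2 hp3 hp5 hpl hpabc hv hi hcell (logvAnalytic_analyticLogv (F := T.K)) M
    archPk archSub Ψ act Mmod region n lat sig split qData (exists_realising_qIdeles_pilotDataOfK T.D).choose
    (exists_realising_thetaIdeles_pilotDataOfK T.D).choose (exists_realising_qIdeles_pilotDataOfK T.D).choose_spec.1
    (exists_realising_qIdeles_pilotDataOfK T.D).choose_spec.2.1 (exists_realising_thetaIdeles_pilotDataOfK T.D).choose_spec.1
    (exists_realising_thetaIdeles_pilotDataOfK T.D).choose_spec.2.2 (exists_realising_qIdeles_pilotDataOfK T.D).choose_spec.2.2 hL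

end Summit.ABC.IUTFork.Conditional

end
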